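import Summits.AtomisticToContinuum.FouriersLaw.Theses.TransferKernelPositivity
import Literature.MathematicalPhysics.KineticTheory.LangevinChainKernel
import Literature.MathematicalPhysics.KineticTheory.LangevinChainGibbs

/-!
# Birth skeleton (BC3) for the crux `TransferKernelPositivity.Passivity`
(crux item stmt-AtomisticToContinuum-12010, rank 4 of route `route-AtomisticToContinuum-TransferKernelPositivity`,
sub-problem `FouriersLaw`; published as `Cruxes/Passivity/Lines/birth.lean`)

Crux (FIXED, concluded BY NAME below): `Summit.AtomisticToContinuum.FouriersLaw.Theses.TransferKernelPositivity.Passivity`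
— for `pinnedChain ω₂ lam β γ` (all `> 0`), under weak-NESS uniqueness, along any steady-state family `μ`, for every
`T > 0`, `N`, site `i` and every limit `t` of the kinetic-temperature response quotient
`(μ_{N,T+δ/2,T-δ/2}(p_i²) - μ_{N,T,T}(p_i²))/δ` (`δ → 0`, `δ ≠ 0`): `|t| ≤ 1/2`.

## The line: the route's own two-layer plan (`Passivity ⇐ ContactRowsNonneg → KernelIdentity`), typed

The route header (TWO-LAYER PLAN) foresees `Passivity ⇐ ContactRowsNonneg → KernelIdentity`: by the open-system
linear-response (Novikov / noise-amplitude) formula the response profile is a difference of two CONTACT ROWS of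
the kinetic-energy transfer kernel, `θ_N(i) = (γ/2T²)(K_N(0,i) - K_N(N-1,i))`,
`K_N(b,i) = ∫₀^∞ Cov_{μ_T}(p_b²(0), p_i²(s)) ds`, the sum rule `(γ/T²)(K_N(0,i) + K_N(N-1,i)) = 1` is
equipartition differentiated along the diagonal `T_L = T_R`, and `Passivity` is then exactly ENTRYWISE
NON-NEGATIVITY of the two contact rows (TP₁, the first sign-regularity condition of Karlin's programme).
This file types that plan over EXISTING vocabulary only — the constructed transition kernels
`OscillatorChain.transitionKernel` (`Literature/…/LangevinChainKernel.lean`) and the Gibbs measure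
`OscillatorChain.gibbsMeasure` (`Literature/…/LangevinChainGibbs.lean`) — writing the contact-row entry with
source (bath) site `b` and target site `i` of the chain with `N + 1` sites `0, …, N` at temperature `T` as the
iterated integral
`A_{N+1}(b,i) := ∫_{s ∈ (0,∞)} ∫ (p_b² - T)(z) · (K_s p_i²)(z) dμ_T(z) ds`,
`K_s = transitionKernel (N+1) T T s` (equal bath temperatures), `μ_T = gibbsMeasure (N+1) T`
(so `A_{N+1}(b,i) = ∫₀^∞ Cov_{μ_T}(p_b², K_s p_i²) ds = K_{N+1}(b,i)`, because `μ_T K_s = μ_T` and `μ_T(p_i²) = T`),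
exactly the shape in which the tree already states the antisymmetric response
(`PuiseuxTransferLedgerFiniteResponseProfile.siteResponse_tendsto`, weight `p_0² - p_N²`). The stubs:

* S1 `stub_kernelIdentity` (KERNEL IDENTITY for the BLR protocol; size S/M, provable now): along the family, the
  response quotient at site `i` tends to `(γ/2T²)(A(0,i) - A(N,i))`. This is `siteResponse_tendsto ∘ gibbsTTCF_site`
  (landed for item 12011, imported here through the route file) with `T = μ_{N+1,T,T}(p_i²)`
  (`steadyFamily_apply_self`, `gibbs_sq_momentum`) and the weight `p_0² - p_N² = (p_0² - T) - (p_N² - T)` SPLIT into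
  the two contact rows — the split needs the separate `s`-integrability of each row on `(0,∞)`
  (`corr_decay` with the mean-zero weights `p_b² - T`), which is the only new work. It is the calibration stub: it
  pins the sign and the factor `γ/2T²` of the kernel dictionary against the tree.
* S2 `stub_sumRule` (SUM RULE; size M): `(γ/T²)(A(0,i) + A(N,i)) = 1` for every `N ≥ 0` and site `i` — the
  response formula in the SYMMETRIC direction `(T_L,T_R) = (T+ε,T+ε)`, where the steady state is the Gibbs state at
  `T+ε` and `μ_{T+ε}(p_i²) = T+ε` exactly (equipartition), so the total bath response is `1`; equivalently the
  equilibrium identity `(p_0² - T) + (p_N² - T) = -γ⁻¹ L_T H` and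
  `∫₀^∞ μ_T((L_T H) · K_s g) ds = -Cov_{μ_T}(H, g) = -T² ∂_T μ_T(g) = -T²` for `g = p_i²` (Kolmogorov equation for
  the kernels on the unbounded observable `H`, Gibbs invariance, mixing `K_s H → μ_T(H)`). One site (`N = 0`,
  `0 = Fin.last 0`, both baths on site `0`): `2(γ/T²)A(0,0) = 1`, consistent with the OU bath of coupling `2γ`.
  Not in the tree (the landed Harris/TTCF line treats the antisymmetric protocol only).
* S3 `stub_contactRowsNonneg` (TP₁ — THE LOAD-BEARING STUB; size L, open for `lam, β > 0`): `0 ≤ A(b,i)` for the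
  two contact rows `b ∈ {0, N}` and every site `i`: the time-integrated equilibrium covariance of the bath-site
  kinetic energy with the later kinetic energy at any site is non-negative. TRUE at the harmonic corner (Isserlis:
  `Cov(p_b², p_i²(s)) = 2 Cov(p_b, p_i(s))² ≥ 0` pointwise in `s`; refuter harmonic scans N ≤ 16: all margins
  positive), TRUE on the diagonal `i = b` for every chain (`A(b,b) = ⟨f, (-L_T)⁻¹ f⟩_{L²(μ_T)} ≥ 0`, `f = p_b² - T`,
  by accretivity of `-L_T`), numerically robust; the anharmonic off-diagonal sign is the crux's open content
  (attacks named by the route: cumulant split `K = 2∫R² + ∫κ₄`, small-anharmonicity / high-`T` expansion,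
  log-concavity of `μ_T`; why it might fail: the connected 4-point part may out-cancel `2∫R²` at intermediate
  anharmonicity — the crux's own why-might-fail, now localised in ONE equilibrium quantity).
* `Passivity_of : Passivity` — kernel-checked composition, no `sorry` of its own: for `N = 0` sites the claim is
  vacuous (`Fin 0`); for `N + 1` sites, uniqueness of limits along `𝓝[≠] 0` identifies `t` with the value of S1,
  and with `a := (γ/T²)A(0,i) ≥ 0`, `b := (γ/T²)A(N,i) ≥ 0` (S3), `a + b = 1` (S2), `t = (a - b)/2` lies in
  `[-1/2, 1/2]` (`passivity_arith`). Logically `S1 → S2 → S3 → Passivity`; the stubs are invoked by name because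
  the skeleton audit admits only named obligations as binders.

Why this cut (planner notes): (i) it is the route's declared mechanism one level down — TP₁ of the contact rows is
the statement the thesis says provers can attack, and S1/S2 are the dictionary (response = kernel column, sum rule)
that makes the equivalence `Passivity ⟺ S3` honest instead of assumed; (ii) every object is tree vocabulary
(no posited `transferKernel` definition is needed: the iterated integral IS the kernel entry, in the normalisation
the tree's TTCF theorems already use), so provers' Theorems files can restate the stubs verbatim; (iii) the
alternative thermodynamic cut (`∂_{T_b} μ(p_i²) ≥ 0` at equilibrium for each bath + Fréchet differentiability of
`(T_L,T_R) ↦ μ_{N,T_L,T_R}(p_i²)` + equipartition) hides the same kernel work below both stubs and needs joint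
differentiability, which the tree does not have (only the protocol direction, item 12011); (iv) the temperature
BRACKET `min(T_L,T_R) ≤ μ_{N,T_L,T_R}(p_i²) ≤ max(T_L,T_R)` (BLLO2009's expected-but-unproved statement) would
give `Passivity` by a squeeze in ONE stub that is strictly stronger than the crux (far from equilibrium) — a
one-stub costume, rejected.

Transfer (declared): GIVEN S1 and S2 (both provable fixed-`N` identities), S3 at `(N,i)` is EQUIVALENT to the
crux at `(N,i)` — this is the intended transfer `Passivity ↝ TP₁` of the route, and WHY EASIER: S3 is a sign
statement about ONE equilibrium object (a Gibbs space–time covariance of the reversible-up-to-momentum-flip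
stationary dynamics at a single temperature), with no NESS, no `δ → 0` limit and no uniqueness hypothesis in it;
Gaussian tools (Isserlis at `lam = β = 0`, cumulant/cluster expansion around it), spectral tools (`(-L_T)⁻¹` on
`L²(μ_T)`, sectoriality gives the diagonal at once) and correlation inequalities apply to it directly, none of
which see the NESS derivative `t`.

Disproof used: none — `Cruxes/Passivity/` had no workfiles at registration (2026-08-17, `ledger crux ls
stmt-AtomisticToContinuum-12010`: "(no workfiles yet)"); no `Negative/` lemma, no dead line; the negatives index
(`ledger negatives --problem AtomisticToContinuum`, 20 entries) has no statement about bath-temperature responses or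
kernel signs. Refuter evidence honoured (rattack-12010, refute-pool g43-8/g44-19, rreview-0815T18-16): the limit
hypothesis of the crux is CONSUMED (uniqueness of limits against S1), never dropped; `N = 0` vacuous and `N = 1`
(`t = 0`, both baths on one site) are consistent with S1–S3 (`A(0,0) = A(last,0)`, sum rule `2(γ/T²)A = 1`);
the harmonic corner, where the refuters verified `|θ| ≤ 0.461 < 1/2` (N ≤ 12) and positive margins (N ≤ 16), is
where S3 is provable (Isserlis), so no stub is refuted by the integrable corner
(`Literature.Barriers.AtomisticToContinuum.HarmonicChainBallisticFlux` concerns the CURRENT, i.e. `LocalOhm`, not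
the profile signs).

BC3 probes (planner folder `bc/probes/`): for each stub `S`, `S → Passivity` and `S → FouriersLaw` by
`first | exact? | simpa | aesop` FAIL (see NOTES.md `birth-certificate:` for rc and messages).
-/

set_option autoImplicit false

noncomputable section

namespace Summit.AtomisticToContinuum.FouriersLaw.Cruxes.Passivity.Birth

open MeasureTheory Filter Topology Set
open scoped BigOperators NNReal
open Literature.MathematicalPhysics.KineticTheory.HeatConduction
open Summit.AtomisticToContinuum.FouriersLaw.Theses.TransferKernelPositivity (Passivity)

set_option linter.unusedVariables false

/-! ## S1 — the kernel identity: the response profile is a difference of two contact rows -/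

/-- **S1 `stub_kernelIdentity`** (KERNEL IDENTITY along the BLR protocol; size S/M, provable now from the tree's
TTCF line). For `P = pinnedChain ω₂ lam β γ` (all `> 0`), under weak-NESS uniqueness, along any steady-state family
`μ`, for every `T > 0`, every `N` and every site `i` of the chain with `N + 1` sites: the kinetic-temperature response
quotient `(μ_{N+1,T+δ/2,T-δ/2}(p_i²) - μ_{N+1,T,T}(p_i²))/δ` CONVERGES as `δ → 0`, `δ ≠ 0`, to
`(γ/(2T²)) · (A(0,i) - A(N,i))`, where
`A(b,i) = ∫_{s∈(0,∞)} ∫ (p_b² - T)(z) · (∫ p_i² dK_s(z,·)) dμ_T(z) ds` is the contact-row entry of the kinetic-energy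
transfer kernel (`K_s = P.transitionKernel (N+1) T T s`, `μ_T = P.gibbsMeasure (N+1) T`;
`A(b,i) = ∫₀^∞ Cov_{μ_T}(p_b², K_s p_i²) ds` since `μ_T K_s = μ_T`, `μ_T(p_i²) = T`). Proof route: the tree's
`PuiseuxTransferLedgerFiniteResponseProfile.siteResponse_tendsto` fed with `gibbsTTCF_site` gives the limit
`(γ/(2T²)) ∫_{(0,∞)} μ_T((p_0² - p_N²) · K_s p_i²) ds` for `(μ(p_i²) - T)/δ`; rewrite `T = μ_{N+1,T,T}(p_i²)`
(`BoundaryKubo.Negative.LoadBearing.steadyFamily_apply_self` + `gibbs_sq_momentum`, as in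
`finiteResponseProfile_proof`) and split the weight `p_0² - p_N² = (p_0² - T) - (p_N² - T)`: `integral_sub` in `z`
(moment bounds `abs_sq_sub_sq_le_exp`-style for each half) and in `s` (`IntegrableOn … (Ioi 0)` of each half from
`PhononMeanFreePathBoundaryKuboLimitExchangeAux1.corr_decay` with the mean-zero weight `p_b² - T`). Why it might
fail: only by a junk-value slip in the split (each half must be shown integrable separately); the identity itself is
landed. It implies `FiniteResponseProfile` (12011, closed) and fixes the sign/normalisation of the dictionary
`θ = (γ/2T²)(K(0,·) - K(N,·))` used by S2/S3. Sources: KunduDharNarayan2009 (open-system response formula),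
ReyBellet2003 Rem. 4.4, HairerMajda2009. -/
theorem stub_kernelIdentity :
    ∀ ω₂ lam β γ : ℝ, 0 < ω₂ → 0 < lam → 0 < β → 0 < γ →
    (∀ (N : ℕ) (T_L T_R : ℝ), 0 < T_L → 0 < T_R → ∀ μ ν : Measure (PhaseSpace N),
      (pinnedChain ω₂ lam β γ).IsSteadyState N T_L T_R μ →
      (pinnedChain ω₂ lam β γ).IsSteadyState N T_L T_R ν → μ = ν) →
    ∀ μ : (N : ℕ) → ℝ → ℝ → Measure (PhaseSpace N),
    (∀ (N : ℕ) (T_L T_R : ℝ), 0 < T_L → 0 < T_R →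
      (pinnedChain ω₂ lam β γ).IsSteadyState N T_L T_R (μ N T_L T_R)) →
    ∀ T : ℝ, 0 < T → ∀ (N : ℕ) (i : Fin (N + 1)),
      Tendsto (fun δ : ℝ => ((∫ x, (x.2 i) ^ 2 ∂(μ (N + 1) (T + δ / 2) (T - δ / 2))) -
          ∫ x, (x.2 i) ^ 2 ∂(μ (N + 1) T T)) / δ) (𝓝[≠] 0)
        (𝓝 (γ / (2 * T ^ 2) *
          ((∫ s in Ioi (0 : ℝ), ∫ z, ((z.2 0) ^ 2 - T) *
              (∫ y, (y.2 i) ^ 2 ∂((pinnedChain ω₂ lam β γ).transitionKernel (N + 1) T T s.toNNReal z))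
              ∂((pinnedChain ω₂ lam β γ).gibbsMeasure (N + 1) T)) -
            (∫ s in Ioi (0 : ℝ), ∫ z, ((z.2 (Fin.last N)) ^ 2 - T) *
              (∫ y, (y.2 i) ^ 2 ∂((pinnedChain ω₂ lam β γ).transitionKernel (N + 1) T T s.toNNReal z))
              ∂((pinnedChain ω₂ lam β γ).gibbsMeasure (N + 1) T))))) := by
  sorry

/-! ## S2 — the sum rule: the two contact rows add up to `T²/γ` -/

/-- **S2 `stub_sumRule`** (SUM RULE of the contact rows; size M; an equilibrium identity of the equal-temperature
dynamics, no NESS in it). For `P = pinnedChain ω₂ lam β γ` (all `> 0`), every `T > 0`, every `N` and every site `i`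
of the chain with `N + 1` sites: `(γ/T²) · (A(0,i) + A(N,i)) = 1` with `A(b,i)` the contact-row entries of S1.
Content: the response formula in the SYMMETRIC direction `(T_L,T_R) = (T+ε,T+ε)` — the perturbation of the generator
is `ε γ (∂²_{p_0} + ∂²_{p_N})`, its Gibbs-relative source is `(γ/T²)((p_0² - T) + (p_N² - T))`, and the perturbed
steady state is the Gibbs state at `T+ε` with `μ_{T+ε}(p_i²) = T+ε` EXACTLY (equipartition,
`pinnedChain_isSteadyState_gibbsMeasure`, `gibbs_sq_momentum`), so the total response of every site to a common
shift of both baths is `1`; equivalently, purely at equilibrium: `(p_0² - T) + (p_N² - T) = -γ⁻¹ L_T H` and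
`∫₀^∞ μ_T((L_T H)(K_s p_i²)) ds = -Cov_{μ_T}(H, p_i²) = -T²` (Kolmogorov equation for `s ↦ μ_T(H · K_s g)`,
Gibbs invariance of `K_s`, decay `K_s H → μ_T(H)` from the Harris bound, `Cov_{μ_T}(H,p_i²) = T² ∂_T μ_T(p_i²) = T²`).
One site (`N = 0`, `Fin.last 0 = 0`): `2(γ/T²)A(0,0) = 1` (OU bath of coupling `2γ`: `∂_{T_L}μ(p²) = 1/2`). Why
plausibly true: it is the fluctuation–dissipation sum rule `∂_{T_L} + ∂_{T_R} = d/dT` at equilibrium, exact at the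
harmonic corner (`a_L + a_R = 1`, refuter Lyapunov scans) and a theorem of linear response at fixed `N`
(HairerMajda2009 Thm 2.3 framework; ReyBellet2003 Rem. 4.4). Why it might fail: only through the time-integrability
/ limit-exchange bookkeeping for the unbounded observables `H`, `p_b²` (exponential moments of CEHR2018 Thm 2.13 are
available: `CuneoEckmannHairerReyBellet2018_pinnedChain_*`, `corr_decay`). Leans on: `LangevinChainKernel`
(Chapman–Kolmogorov, Feller), `LangevinChainGibbs` (Gibbs invariance), the landed Harris stubs of line `gibbs-ttcf`
(`stub_uniformHarris_of_minorization …`), `gibbs_sq_momentum`. Sources: KunduDharNarayan2009, DharRoy2006 (harmonic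
multi-terminal sum-to-one), ReyBellet2003, BonettoLebowitzLukkarinen2004. -/
theorem stub_sumRule :
    ∀ ω₂ lam β γ : ℝ, 0 < ω₂ → 0 < lam → 0 < β → 0 < γ → ∀ T : ℝ, 0 < T →
    ∀ (N : ℕ) (i : Fin (N + 1)),
      γ / T ^ 2 *
        ((∫ s in Ioi (0 : ℝ), ∫ z, ((z.2 0) ^ 2 - T) *
            (∫ y, (y.2 i) ^ 2 ∂((pinnedChain ω₂ lam β γ).transitionKernel (N + 1) T T s.toNNReal z))
            ∂((pinnedChain ω₂ lam β γ).gibbsMeasure (N + 1) T)) +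
          (∫ s in Ioi (0 : ℝ), ∫ z, ((z.2 (Fin.last N)) ^ 2 - T) *
            (∫ y, (y.2 i) ^ 2 ∂((pinnedChain ω₂ lam β γ).transitionKernel (N + 1) T T s.toNNReal z))
            ∂((pinnedChain ω₂ lam β γ).gibbsMeasure (N + 1) T))) = 1 := by
  sorry

/-! ## S3 — TP₁: the contact rows of the kinetic-energy transfer kernel are entrywise non-negative -/

/-- **S3 `stub_contactRowsNonneg`** (TP₁ / THERMAL PASSIVITY IN KERNEL FORM — the load-bearing stub; size L, open for
`lam, β > 0`). For `P = pinnedChain ω₂ lam β γ` (all `> 0`), every `T > 0`, every `N`, every CONTACT (bath) site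
`b ∈ {0, N}` and every site `i` of the chain with `N + 1` sites:
`0 ≤ A(b,i) = ∫_{s∈(0,∞)} ∫ (p_b² - T)(z) · (K_s p_i²)(z) dμ_T(z) ds` (`= ∫₀^∞ Cov_{μ_T}(p_b², p_i²(s)) ds`): heating a
bath site's kinetic-energy fluctuation is, integrated over time, non-negatively correlated with the later kinetic
energy everywhere — the two contact rows `(γ/T²)K(b,·)` of the transfer kernel are entrywise `≥ 0` (with S2 they lie
in `[0,1]`). Reading through S1/S2: `(γ/T²)A(0,i) = ∂_{T_L} μ(p_i²)|_{T_L=T_R=T}` (one-bath passivity, "no site cools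
when a bath is heated, to first order at equilibrium"). Why plausibly true: (a) HARMONIC corner `lam = β = 0`:
Isserlis gives `Cov(p_b², p_i²(s)) = 2 Cov(p_b, p_i(s))² ≥ 0` for every `s`, so `A ≥ 0` row-wise (provable from
`Literature` `harmonicNESS`/`chainCov`; refuter scans N ≤ 16: interior margins `≥ 0.429`, contacts `≥ 4.2e-4`);
(b) DIAGONAL `i = b`, every chain: `A(b,b) = ⟨f, (-L_T)⁻¹ f⟩_{L²(μ_T)} ≥ 0`, `f = p_b² - T`, since `-L_T` is
maximal accretive on `L²(μ_T)`; (c) one site: `A(0,0) = T²/(2γ) > 0` by S2. Attacks (route header): cumulant split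
`Cov(p_b², p_i²(s)) = 2R_{bi}(s)² + κ₄(s)` with the connected part controlled at small `(lam, β)` or high `T`
(cluster expansion around the Gaussian corner), second-order Malliavin / curvature expansion, log-concavity of `μ_T`
(`U'' , V'' > 0`). Why it might fail: the time-integrated connected 4-point part may out-cancel `2∫R²` at
intermediate anharmonicity, half a local period away (the crux's own why-might-fail; BLLO2009 arXiv:0809.0953 p. 6:
expected but unproved even with bulk noise); a NEGATIVE contact-row entry at a bulk site, stable in `N`, refutes it and
the crux together (route kill criterion (b)). Leans on: `LangevinChainKernel`, `LangevinChainGibbs`,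
`HarmonicChainNESS` (corner), `VelocityFlipNoise.measurePreserving_momentumFlip_gibbsMeasure` (reversibility up to
flip). Sources: RiederLebowitzLieb1967, KunduDharNarayan2009, DharRoy2006, BonettoLebowitzLukkarinenOlla2009,
Karlin1968 (TP₁). -/
theorem stub_contactRowsNonneg :
    ∀ ω₂ lam β γ : ℝ, 0 < ω₂ → 0 < lam → 0 < β → 0 < γ → ∀ T : ℝ, 0 < T →
    ∀ (N : ℕ) (b i : Fin (N + 1)), (b = 0 ∨ b = Fin.last N) →
      0 ≤ ∫ s in Ioi (0 : ℝ), ∫ z, ((z.2 b) ^ 2 - T) *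
            (∫ y, (y.2 i) ^ 2 ∂((pinnedChain ω₂ lam β γ).transitionKernel (N + 1) T T s.toNNReal z))
            ∂((pinnedChain ω₂ lam β γ).gibbsMeasure (N + 1) T) := by
  sorry

/-! ## The composition: `Passivity` from S1, S2, S3 -/

/-- The arithmetic of TP₁ + sum rule: if `t = (γ/2T²)(A₀ - A₁)`, `(γ/T²)(A₀ + A₁) = 1` and `A₀, A₁ ≥ 0`, then
`|t| ≤ 1/2` (`a = (γ/T²)A₀`, `b = (γ/T²)A₁` are `≥ 0` with `a + b = 1` and `t = (a-b)/2`). [folklore] -/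
theorem passivity_arith {γ T A0 A1 t : ℝ} (hγ : 0 < γ) (hT : 0 < T)
    (ht : t = γ / (2 * T ^ 2) * (A0 - A1)) (hsum : γ / T ^ 2 * (A0 + A1) = 1)
    (h0 : 0 ≤ A0) (h1 : 0 ≤ A1) : |t| ≤ 1 / 2 := by
  have hpos : 0 < γ / T ^ 2 := div_pos hγ (pow_pos hT 2)
  have ha : 0 ≤ γ / T ^ 2 * A0 := mul_nonneg hpos.le h0
  have hb : 0 ≤ γ / T ^ 2 * A1 := mul_nonneg hpos.le h1
  have ht2 : t = (γ / T ^ 2 * A0 - γ / T ^ 2 * A1) / 2 := by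
    rw [ht]; ring
  have hs : γ / T ^ 2 * A0 + γ / T ^ 2 * A1 = 1 := by rw [← mul_add]; exact hsum
  rw [abs_le]
  constructor <;> linarith

/-- **`Passivity_of`** — the kernel-checked composition (no `sorry` of its own): `Passivity` follows from
`stub_kernelIdentity` (S1), `stub_sumRule` (S2) and `stub_contactRowsNonneg` (S3). For `N = 0` there is no site; for
`N + 1` sites the limit `t` of the crux is the value of S1 (uniqueness of limits along the proper filter `𝓝[≠] 0`),
and `passivity_arith` closes with S2 and S3 at the two contact rows `b = 0`, `b = Fin.last N`. (The stubs are invoked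
by name rather than taken as hypotheses because the skeleton audit admits only named obligations; logically this is
`S1 → S2 → S3 → Passivity`.) -/
theorem Passivity_of : Passivity := by
  intro ω₂ lam β γ hω hl hβ hγ hU μ hμ T hT N i t ht
  cases N with
  | zero => exact i.elim0
  | succ M =>
    have h1 := stub_kernelIdentity ω₂ lam β γ hω hl hβ hγ hU μ hμ T hT M i
    have h2 := stub_sumRule ω₂ lam β γ hω hl hβ hγ T hT M i
    have h3 := stub_contactRowsNonneg ω₂ lam β γ hω hl hβ hγ T hT M 0 i (Or.inl rfl)
    have h4 := stub_contactRowsNonneg ω₂ lam β γ hω hl hβ hγ T hT M (Fin.last M) i (Or.inr rfl)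
    exact passivity_arith hγ hT (tendsto_nhds_unique ht h1) h2 h3 h4

end Summit.AtomisticToContinuum.FouriersLaw.Cruxes.Passivity.Birth

end
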